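import Literature.Analysis.FluidPDE.OnsagerFlexibilityAssembly
import Literature.Analysis.FluidPDE.OnsagerBDSVOscillationPrincipalProofs
import Literature.Analysis.FluidPDE.OnsagerBDSVCommutatorHolds
import Literature.Analysis.FluidPDE.OnsagerBDSVTransportErrorHolds
import Literature.Analysis.FluidPDE.OnsagerBDSVGluingStabilityHolds
import Literature.Analysis.FluidPDE.EulerTorusShortTimeProofs
import HarnessLib

/-!
# BDSV Thm. 1.1 (Onsager flexibility with a prescribed energy profile): the discharges

Buckmaster–De Lellis–Székelyhidi–Vicol (BDSV), *Onsager's conjecture for admissible weak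
solutions*, Comm. Pure Appl. Math. **72** (2019) 229–274 = arXiv:1701.08678.  Every input of the
tree's assembly of Thm. 1.1 is now a theorem, so the four named facts at the top of the BDSV
chain are discharged here by composition (same import closure as
`OnsagerStrictAntiOnProofs.lean`, which already discharges the strictly-dissipative corollary
`onsager_flexibility_strictAntiOn` this way):

* `BDSV.stressEstimate_holds` — Prop. 6.1 (the Reynolds-stress estimate of the perturbation
  stage): `BDSV.stressEstimate_of_errors` (§6.1, proved) fed with the Nash error (6.5)
  `BDSV.nashErrorEstimate_holds`, the transport error (6.8) `BDSV.transportErrorEstimate_holds`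
  and the oscillation error (6.12) `BDSV.oscillationErrorEstimate_holds`;
* `BDSV.stagesEstimate_holds`, `BDSV.mainIteration_holds` — the stages estimate of §2.3–2.6 and
  the main iterative Proposition 2.1: `BDSV.stagesEstimate_of_remaining` /
  `BDSV.mainIteration_of_remaining` (`OnsagerBDSVMainReduction.lean`) fed with
  `Torus.eulerSmoothShortTime_holds` (Majda–Bertozzi Thm. 3.4, the input of Prop. 3.1),
  `BDSV.gluingStability_holds` (§3), `BDSV.gluedTripleEstimates_holds` (§4) and Prop. 6.1;
* `onsager_flexibility_holds` — **Thm. 1.1** ("Assume `e : [0,T] → ℝ` is a strictly positive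
  smooth function. Then for any `0 < β < 1/3` there exists a weak solution `v ∈ C^β(T³ × [0,T])`
  with `∫_{T³} |v(x,t)|² dx = e(t)`"), the named fact `onsager_flexibility` of `Onsager.lean`:
  `onsager_flexibility_of_remaining` (`OnsagerFlexibilityAssembly.lean`, §2.2 + Prop. 2.1 + the
  proved time-regularity step) fed with the same four discharges.

No new mathematics: this file only records the compositions, so that the facts leave the
named-fact debt (the docstrings of `OnsagerBDSVMainReduction.lean` and
`OnsagerFlexibilityAssembly.lean` announce exactly these one-liners "when these are discharged").

## References

* T. Buckmaster, C. De Lellis, L. Székelyhidi Jr., V. Vicol, CPAM 72 (2019) 229–274 =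
  arXiv:1701.08678: Thm. 1.1, Prop. 2.1, §2.3–2.6, Prop. 6.1. [BuckmasterEtAl2018]
* A. J. Majda, A. L. Bertozzi, *Vorticity and incompressible flow*, CUP 2002, Thm. 3.4.
-/

namespace Literature.Analysis.FluidPDE

namespace BDSV

/-- **BDSV Prop. 6.1 holds** (the Reynolds-stress estimate of the perturbation stage, named fact
`BDSV.stressEstimate` of `OnsagerBDSVPerturbation.lean`): §6.1's split
`BDSV.stressEstimate_of_errors` fed with the proved Nash error (6.5), transport error (6.8) and
oscillation error (6.12). [cite: BuckmasterEtAl2018, Prop. 6.1 and §6.1] -/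
theorem stressEstimate_holds : BDSV.stressEstimate :=
  stressEstimate_of_errors nashErrorEstimate_holds transportErrorEstimate_holds
    oscillationErrorEstimate_holds

/-- **The BDSV stages estimate holds** (named fact `BDSV.stagesEstimate` of
`OnsagerBDSVStages.lean`, §2.3–2.6): `BDSV.stagesEstimate_of_remaining` fed with short-time smooth
Euler on `T³`, the §3 stability estimates, the §4 glued-triple estimates and Prop. 6.1.
[cite: BuckmasterEtAl2018, §2.3–2.6] -/
theorem stagesEstimate_holds : BDSV.stagesEstimate :=
  stagesEstimate_of_remaining Torus.eulerSmoothShortTime_holds gluingStability_holds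
    gluedTripleEstimates_holds stressEstimate_holds

/-- **BDSV Prop. 2.1 holds** (the main iterative proposition, named fact `BDSV.mainIteration` of
`OnsagerBDSV.lean`): `BDSV.mainIteration_of_remaining` fed with the same four discharges.
[cite: BuckmasterEtAl2018, Prop. 2.1 (proof, §2.6)] -/
theorem mainIteration_holds : BDSV.mainIteration :=
  mainIteration_of_remaining Torus.eulerSmoothShortTime_holds gluingStability_holds
    gluedTripleEstimates_holds stressEstimate_holds

end BDSV

/-- **BDSV Theorem 1.1 holds — Hölder-continuous weak Euler flows on `T³` with any prescribed
smooth positive energy profile, for every exponent below `1/3`** (named fact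
`onsager_flexibility` of `Onsager.lean`: for `α < 1/3`, `T > 0` and `e` smooth and positive on
`[0,T]`, a weak Euler solution on `T³`, `α`-Hölder on `[0,T] × T³`, with `½∫|u(t)|² = e(t)` on
`[0,T]`): the proved §2.2 assembly `onsager_flexibility_of_remaining` fed with
`Torus.eulerSmoothShortTime_holds` (Majda–Bertozzi Thm. 3.4), `BDSV.gluingStability_holds` (§3),
`BDSV.gluedTripleEstimates_holds` (§4) and `BDSV.stressEstimate_holds` (Prop. 6.1).
[cite: BuckmasterEtAl2018, Thm. 1.1] -/
theorem onsager_flexibility_holds : onsager_flexibility :=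
  onsager_flexibility_of_remaining Torus.eulerSmoothShortTime_holds BDSV.gluingStability_holds
    BDSV.gluedTripleEstimates_holds BDSV.stressEstimate_holds

end Literature.Analysis.FluidPDE
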